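import Mathlib
import Literature.Analysis.Complex.DbarFrequencyFunction
import HarnessLib

/-!
# The frequency function of `‖∂̄h‖ ≤ M‖h‖`, II: polynomial lower bound on circles, strong unique continuation

Part I (`Literature/Analysis/Complex/DbarFrequencyFunction.lean`) proved, for a `C²` and
`2πi`-periodic `g : ℂ → F` (`F` a complex inner-product space) with `‖∂ₛg + i∂_θ g‖ ≤ c eˢ‖g‖`,
the lower bound `H(s) ≥ H(s₀) e^{2κ(s-s₀)}` (`s ≤ s₀`) for `H(s) = ∫₀^{2π} ‖g(s+iθ)‖² dθ`.
Here this is translated to a map `h` defined near the origin of the plane through `g = h ∘ exp`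
(after a smooth cut-off outside the disc of interest): for `h` of class `C²` on a punctured disc
`B(0,R) ∖ {0}` with

  `‖Dh(z)(1) + i Dh(z)(i)‖ ≤ M ‖h z‖`   (`= 2‖∂̄h‖ ≤ M‖h‖`)   on `B(0,R) ∖ {0}`,

* `apply_add_I_smul_apply_I_mul`: the pointwise identity `L z + i L(iz) = z̄ • (L 1 + i L i)` for a
  real-linear `L : ℂ → F`, giving `∂ₛg + i∂_θg = z̄ • (Dh(z) 1 + i Dh(z) i)` at `z = e^{s+iθ}`, of
  norm `≤ eˢ M ‖g‖`;
* `circle_sqNorm_lower_bound`: if `H(r₀) = ∫₀^{2π} ‖h(r₀e^{iθ})‖² dθ > 0` (`0 < r₀ < R`) then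
  `H(r) ≥ H(r₀) (r/r₀)^κ` for some `κ > 0` and all `0 < r ≤ r₀` — the **doubling / polynomial
  lower bound** of the frequency method (Garofalo–Lin 1986) for the Cauchy–Riemann operator;
* `circle_sqNorm_pos_of_pos`: positivity of `H` propagates to all smaller circles;
* `eq_zero_of_flat`: **strong unique continuation** — if moreover `h` vanishes to infinite order
  at `0` (`‖h z‖ ≤ C_m ‖z‖^m` near `0` for every `m`), then `h = 0` on `B(0,R) ∖ {0}`
  (T. Carleman 1939; for `J`-holomorphic curves: McDuff 1991 Lemma 2.3, Wendl 2020 §B.1);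
* `exists_order_of_ne_zero`: contrapositive — a solution that is not identically zero vanishes
  to finite order only.

Everything is proved; no named facts. Consumers: the finite order of vanishing and holomorphic
leading term of `J`-holomorphic curves (Wendl 2020, Thm B.23 / Cor B.21, first step of the local
representation formula).

## References

* T. Carleman, *Sur un problème d'unicité pour les systèmes d'équations aux dérivées partielles à
  deux variables indépendantes*, Ark. Mat. Astr. Fys. 26B (1939), no. 17. [Carleman1939Unicite]
* N. Garofalo, F.-H. Lin, *Monotonicity properties of variational integrals, `A_p` weights and
  unique continuation*, Indiana Univ. Math. J. 35 (1986), Thm 1.1 / (1.4). [GarofaloLin1986]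
* D. McDuff, *The local behaviour of holomorphic curves in almost complex 4-manifolds*,
  J. Differential Geom. 34 (1991), Lemma 2.3. [McDuff1991LocalBehaviour]
* C. Wendl, *Lectures on Contact 3-Manifolds, Holomorphic Curves and Intersection Theory* (2020),
  App. B, Thm B.20–Cor B.21. [Wendl2020]
-/

noncomputable section

open scoped ContDiff Topology ComplexConjugate
open Complex MeasureTheory intervalIntegral Set Filter Metric

namespace Literature.Analysis.Complex

namespace DbarFrequency

variable {F : Type*} [NormedAddCommGroup F] [InnerProductSpace ℂ F]

/-! ### Pointwise algebra: the `∂̄`-defect in logarithmic coordinates -/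

/-- For a real-linear `L : ℂ → F` into a complex vector space and `z ∈ ℂ`:
`L z + i • L (i z) = z̄ • (L 1 + i • L i)`. With `L = Dh(z)` and `z = e^w` the left side is
`∂ₛ(h ∘ exp)(w) + i ∂_θ(h ∘ exp)(w)`, the right side `z̄ • 2∂̄h(z)`. [folklore] -/
theorem apply_add_I_smul_apply_I_mul (L : ℂ →L[ℝ] F) (z : ℂ) :
    L z + I • L (I * z) = (starRingEnd ℂ z) • (L 1 + I • L I) := by
  have hz : z = z.re • (1 : ℂ) + z.im • I := by
    apply Complex.ext <;> simp
  have hIz : I * z = (-z.im) • (1 : ℂ) + z.re • I := by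
    apply Complex.ext <;> simp
  have hL : L z = z.re • L 1 + z.im • L I := by
    conv_lhs => rw [hz]
    rw [map_add, L.map_smul, L.map_smul]
  have hLI : L (I * z) = (-z.im) • L 1 + z.re • L I := by
    rw [hIz, map_add, L.map_smul, L.map_smul]
  have hconj : (starRingEnd ℂ) z = (z.re : ℂ) + (-z.im : ℂ) * I := by
    apply Complex.ext <;> simp
  rw [hL, hLI, hconj]
  simp only [← Complex.coe_smul, Complex.ofReal_neg]
  match_scalars
  · ring
  · linear_combination (z.im : ℂ) * I_mul_I

/-- Norm form: `‖L z + i L(iz)‖ = ‖z‖ ‖L 1 + i L i‖`. [folklore] -/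
theorem norm_apply_add_I_smul_apply_I_mul (L : ℂ →L[ℝ] F) (z : ℂ) :
    ‖L z + I • L (I * z)‖ = ‖z‖ * ‖L 1 + I • L I‖ := by
  rw [apply_add_I_smul_apply_I_mul, norm_smul, Complex.norm_conj]

/-! ### The logarithmic lift `g = (χ • h) ∘ exp` -/

section Lift

variable {h : ℂ → F} {R : ℝ}

/-- The cut-off `χ • h` of a map that is `C²` on the punctured disc `B(0,R) ∖ {0}`, by a bump `χ`
supported inside `B(0,R)`, is `C²` on `ℂ ∖ {0}`. [folklore] -/
theorem contDiffAt_cutoff_smul (hh : ContDiffOn ℝ 2 h (ball (0 : ℂ) R \ {0}))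
    (χ : ContDiffBump (0 : ℂ)) (hχR : χ.rOut < R) {z : ℂ} (hz : z ≠ 0) :
    ContDiffAt ℝ 2 (fun z => (χ z) • h z) z := by
  by_cases hzR : ‖z‖ < R
  · have hU : ball (0 : ℂ) R \ {0} ∈ 𝓝 z :=
      (isOpen_ball.sdiff isClosed_singleton).mem_nhds ⟨by simpa using hzR, hz⟩
    exact χ.contDiff.contDiffAt.smul (hh.contDiffAt hU)
  · have hz' : z ∉ tsupport (χ : ℂ → ℝ) := by
      rw [χ.tsupport_eq, mem_closedBall, dist_zero_right, not_le]
      linarith [not_lt.mp hzR]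
    have h0 : (fun z => (χ z) • h z) =ᶠ[𝓝 z] fun _ => 0 := by
      filter_upwards [notMem_tsupport_iff_eventuallyEq.mp hz'] with w hw
      simp [hw]
    exact contDiffAt_const.congr_of_eventuallyEq h0

/-- The lift `g(w) = (χ • h)(e^w)` is `C²` on all of `ℂ` (`e^w ≠ 0`). [folklore] -/
theorem contDiff_lift (hh : ContDiffOn ℝ 2 h (ball (0 : ℂ) R \ {0}))
    (χ : ContDiffBump (0 : ℂ)) (hχR : χ.rOut < R) :
    ContDiff ℝ 2 (fun w : ℂ => (χ (exp w)) • h (exp w)) := by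
  rw [contDiff_iff_contDiffAt]
  intro w
  exact (contDiffAt_cutoff_smul hh χ hχR (Complex.exp_ne_zero w)).comp w
    Complex.contDiff_exp.contDiffAt

/-- The lift is `2πi`-periodic. [folklore] -/
theorem lift_periodic (χ : ContDiffBump (0 : ℂ)) (w : ℂ) :
    (fun w : ℂ => (χ (exp w)) • h (exp w)) (w + 2 * Real.pi * I) =
      (fun w : ℂ => (χ (exp w)) • h (exp w)) w := by
  simp only [Complex.exp_add, Complex.exp_two_pi_mul_I, mul_one]

/-- Chain rule for the lift where the cut-off is `1`: `Dg(w) v = Dh(e^w)(v e^w)`. [folklore] -/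
theorem fderiv_lift_apply (hh : ContDiffOn ℝ 2 h (ball (0 : ℂ) R \ {0}))
    (χ : ContDiffBump (0 : ℂ)) {w : ℂ} (hw : ‖exp w‖ < χ.rIn) (hwR : ‖exp w‖ < R) (v : ℂ) :
    fderiv ℝ (fun w : ℂ => (χ (exp w)) • h (exp w)) w v = fderiv ℝ h (exp w) (v * exp w) := by
  have h1 : (fun z => (χ z) • h z) =ᶠ[𝓝 (exp w)] h := by
    filter_upwards [χ.eventuallyEq_one_of_mem_ball (by simpa using hw)] with z hz
    simp [hz]
  have hU : ball (0 : ℂ) R \ {0} ∈ 𝓝 (exp w) :=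
    (isOpen_ball.sdiff isClosed_singleton).mem_nhds ⟨by simpa using hwR, Complex.exp_ne_zero w⟩
  have hdh : DifferentiableAt ℝ h (exp w) :=
    (hh.differentiableOn (by simp)).differentiableAt hU
  have hdh' : DifferentiableAt ℝ (fun z => (χ z) • h z) (exp w) := hdh.congr_of_eventuallyEq h1
  have hexp : HasFDerivAt Complex.exp
      ((ContinuousLinearMap.smulRight (1 : ℂ →L[ℂ] ℂ) (exp w)).restrictScalars ℝ) w :=
    (Complex.hasDerivAt_exp w).hasFDerivAt.restrictScalars ℝ
  have hcomp : fderiv ℝ ((fun z => (χ z) • h z) ∘ Complex.exp) w =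
      (fderiv ℝ (fun z => (χ z) • h z) (exp w)).comp (fderiv ℝ Complex.exp w) :=
    fderiv_comp w hdh' hexp.differentiableAt
  have : (fun w : ℂ => (χ (exp w)) • h (exp w)) = (fun z => (χ z) • h z) ∘ Complex.exp := rfl
  rw [this, hcomp, ContinuousLinearMap.comp_apply, hexp.fderiv, h1.fderiv_eq]
  simp [smul_eq_mul]

end Lift

/-! ### The polynomial lower bound on circles -/

/-- `‖r e^{iθ}‖ = r` for `r ≥ 0`. [folklore] -/
theorem norm_ofReal_mul_exp_mul_I {r : ℝ} (hr : 0 ≤ r) (θ : ℝ) :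
    ‖(r : ℂ) * exp (θ * I)‖ = r := by
  rw [norm_mul, Complex.norm_exp_ofReal_mul_I, mul_one, Complex.norm_real, Real.norm_eq_abs,
    abs_of_nonneg hr]

/-- **Polynomial lower bound for the circle means of a solution of `‖∂̄h‖ ≤ M‖h‖`** (frequency
function method). Let `h` be `C²` on the punctured disc `B(0,R) ∖ {0}` with values in a complex
inner-product space and `‖Dh(z)1 + i Dh(z)i‖ ≤ M‖h z‖` there. If
`H(r₀) = ∫₀^{2π} ‖h(r₀ e^{iθ})‖² dθ > 0` for some `0 < r₀ < R`, then there is `κ > 0` with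
`H(r₀) (r/r₀)^κ ≤ H(r)` for all `0 < r ≤ r₀`.
[cite: GarofaloLin1986, Thm 1.1 and (1.4) (frequency/doubling method); Carleman1939Unicite, Théorème 1] -/
theorem circle_sqNorm_lower_bound {h : ℂ → F} {R M r₀ : ℝ}
    (hh : ContDiffOn ℝ 2 h (ball (0 : ℂ) R \ {0}))
    (hM : ∀ z ∈ ball (0 : ℂ) R \ {0}, ‖fderiv ℝ h z 1 + I • fderiv ℝ h z I‖ ≤ M * ‖h z‖)
    (hr₀ : 0 < r₀) (hr₀R : r₀ < R)
    (hpos : 0 < ∫ θ in (0 : ℝ)..2 * Real.pi, ‖h (r₀ * exp (θ * I))‖ ^ 2) :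
    ∃ κ : ℝ, 0 < κ ∧ ∀ r : ℝ, 0 < r → r ≤ r₀ →
      (∫ θ in (0 : ℝ)..2 * Real.pi, ‖h (r₀ * exp (θ * I))‖ ^ 2) * (r / r₀) ^ κ ≤
        ∫ θ in (0 : ℝ)..2 * Real.pi, ‖h (r * exp (θ * I))‖ ^ 2 := by
  -- a bump equal to `1` on a neighbourhood of the closed disc of radius `r₀`, supported in `B(0,R)`
  have hr₀₁ : r₀ < r₀ + (R - r₀) / 3 := by linarith
  have hr₁₂ : r₀ + (R - r₀) / 3 < r₀ + 2 * (R - r₀) / 3 := by linarith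
  have hr₂R : r₀ + 2 * (R - r₀) / 3 < R := by linarith
  let χ : ContDiffBump (0 : ℂ) := ⟨r₀ + (R - r₀) / 3, r₀ + 2 * (R - r₀) / 3, by linarith, hr₁₂⟩
  set g : ℂ → F := fun w => (χ (exp w)) • h (exp w) with hg_def
  have hg : ContDiff ℝ 2 g := contDiff_lift hh χ hr₂R
  have hper : ∀ w, g (w + 2 * Real.pi * I) = g w := lift_periodic χ
  set s₀ : ℝ := Real.log r₀ with hs₀
  have hexp_s₀ : Real.exp s₀ = r₀ := Real.exp_log hr₀
  have hnorm : ∀ s θ : ℝ, ‖exp ((s : ℂ) + θ * I)‖ = Real.exp s := by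
    intro s θ; rw [Complex.norm_exp]; simp
  have hexp_eq : ∀ s θ : ℝ, exp ((s : ℂ) + θ * I) = (Real.exp s : ℂ) * exp (θ * I) := by
    intro s θ; rw [Complex.exp_add, Complex.ofReal_exp]
  have hle_of : ∀ s : ℝ, s ≤ s₀ → ∀ θ : ℝ, ‖exp ((s : ℂ) + θ * I)‖ ≤ r₀ := by
    intro s hs θ; rw [hnorm, ← hexp_s₀]; exact Real.exp_le_exp.2 hs
  -- `g = h ∘ exp` on `Re w ≤ s₀`
  have hg_eq : ∀ s : ℝ, s ≤ s₀ → ∀ θ : ℝ,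
      g ((s : ℂ) + θ * I) = h ((Real.exp s : ℂ) * exp (θ * I)) := by
    intro s hs θ
    have hχ1 : χ (exp ((s : ℂ) + θ * I)) = 1 :=
      χ.one_of_mem_closedBall (by
        rw [mem_closedBall, dist_zero_right]; exact (hle_of s hs θ).trans hr₀₁.le)
    show (χ (exp ((s : ℂ) + θ * I))) • h (exp ((s : ℂ) + θ * I)) = _
    rw [hχ1, one_smul, hexp_eq]
  -- the defect estimate `‖∂ₛg + i∂_θg‖ ≤ (max M 0) eˢ ‖g‖` for `s ≤ s₀`
  have he : ∀ s : ℝ, s ≤ s₀ → ∀ θ : ℝ,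
      ‖fderiv ℝ g ((s : ℂ) + θ * I) 1 + I • fderiv ℝ g ((s : ℂ) + θ * I) I‖ ≤
        max M 0 * Real.exp s * ‖g ((s : ℂ) + θ * I)‖ := by
    intro s hs θ
    set w : ℂ := (s : ℂ) + θ * I with hw
    have hwr : ‖exp w‖ ≤ r₀ := hle_of s hs θ
    have hw1 : ‖exp w‖ < χ.rIn := hwr.trans_lt hr₀₁
    have hwR : ‖exp w‖ < R := hwr.trans_lt hr₀R
    have hmem : exp w ∈ ball (0 : ℂ) R \ {0} := ⟨by simpa using hwR, Complex.exp_ne_zero w⟩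
    rw [fderiv_lift_apply hh χ hw1 hwR, fderiv_lift_apply hh χ hw1 hwR, one_mul,
      norm_apply_add_I_smul_apply_I_mul, hnorm]
    have hgw : g w = h (exp w) := by rw [hw, hg_eq s hs θ, hexp_eq]
    rw [hgw]
    calc Real.exp s * ‖fderiv ℝ h (exp w) 1 + I • fderiv ℝ h (exp w) I‖
        ≤ Real.exp s * (M * ‖h (exp w)‖) :=
          mul_le_mul_of_nonneg_left (hM _ hmem) (Real.exp_pos s).le
      _ ≤ Real.exp s * (max M 0 * ‖h (exp w)‖) :=
          mul_le_mul_of_nonneg_left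
            (mul_le_mul_of_nonneg_right (le_max_left M 0) (norm_nonneg _)) (Real.exp_pos s).le
      _ = max M 0 * Real.exp s * ‖h (exp w)‖ := by ring
  -- positivity of `H(s₀)`
  have hpos' : 0 < ∫ θ in (0 : ℝ)..2 * Real.pi, ‖g ((s₀ : ℂ) + θ * I)‖ ^ 2 := by
    simpa only [hg_eq s₀ le_rfl, hexp_s₀] using hpos
  obtain ⟨κ, hκ⟩ := sqNormCircle_lower_bound hg hper (le_max_right M 0) he hpos'
  refine ⟨max (2 * κ) 1, lt_of_lt_of_le one_pos (le_max_right _ _), fun r hr hrle => ?_⟩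
  have hs : Real.log r ≤ s₀ := Real.log_le_log hr hrle
  have hmain := hκ (Real.log r) hs
  simp only [hg_eq s₀ le_rfl, hexp_s₀, hg_eq (Real.log r) hs, Real.exp_log hr] at hmain
  have hquot : 0 < r / r₀ := div_pos hr hr₀
  have hquot1 : r / r₀ ≤ 1 := (div_le_one hr₀).2 hrle
  have hexp_rpow : Real.exp (2 * κ * (Real.log r - s₀)) = (r / r₀) ^ (2 * κ) := by
    rw [Real.rpow_def_of_pos hquot, Real.log_div hr.ne' hr₀.ne', hs₀]; ring_nf
  rw [hexp_rpow] at hmain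
  have hmono : (r / r₀) ^ (max (2 * κ) 1) ≤ (r / r₀) ^ (2 * κ) :=
    Real.rpow_le_rpow_of_exponent_ge hquot hquot1 (le_max_left _ _)
  exact (mul_le_mul_of_nonneg_left hmono hpos.le).trans hmain

/-- **Positivity of the circle means propagates inwards.** [cite: Carleman1939Unicite, Théorème 1] -/
theorem circle_sqNorm_pos_of_pos {h : ℂ → F} {R M r₀ : ℝ}
    (hh : ContDiffOn ℝ 2 h (ball (0 : ℂ) R \ {0}))
    (hM : ∀ z ∈ ball (0 : ℂ) R \ {0}, ‖fderiv ℝ h z 1 + I • fderiv ℝ h z I‖ ≤ M * ‖h z‖)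
    (hr₀ : 0 < r₀) (hr₀R : r₀ < R)
    (hpos : 0 < ∫ θ in (0 : ℝ)..2 * Real.pi, ‖h (r₀ * exp (θ * I))‖ ^ 2)
    {r : ℝ} (hr : 0 < r) (hrle : r ≤ r₀) :
    0 < ∫ θ in (0 : ℝ)..2 * Real.pi, ‖h (r * exp (θ * I))‖ ^ 2 := by
  obtain ⟨κ, -, hκ⟩ := circle_sqNorm_lower_bound hh hM hr₀ hr₀R hpos
  exact lt_of_lt_of_le (mul_pos hpos (Real.rpow_pos_of_pos (div_pos hr hr₀) κ)) (hκ r hr hrle)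

/-! ### Strong unique continuation -/

omit [InnerProductSpace ℂ F] in
/-- The circle means of a map continuous on the punctured disc are continuous in the angle.
[folklore] -/
theorem continuous_norm_sq_circle {h : ℂ → F} {R r : ℝ} (hc : ContinuousOn h (ball (0 : ℂ) R \ {0}))
    (hr : 0 < r) (hrR : r < R) :
    Continuous fun θ : ℝ => ‖h (r * exp (θ * I))‖ ^ 2 := by
  have hmem : ∀ θ : ℝ, (r : ℂ) * exp (θ * I) ∈ ball (0 : ℂ) R \ {0} := by
    intro θ
    refine ⟨?_, ?_⟩
    · rw [mem_ball, dist_zero_right, norm_ofReal_mul_exp_mul_I hr.le]; exact hrR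
    · have hne : ‖(r : ℂ) * exp (θ * I)‖ ≠ 0 := by
        rw [norm_ofReal_mul_exp_mul_I hr.le]; exact hr.ne'
      exact norm_ne_zero_iff.mp hne
  exact ((hc.comp_continuous (by fun_prop) hmem).norm).pow 2

/-- A point of the circle of radius `‖z‖` in the parametrisation `θ ∈ [0, 2π]`. [folklore] -/
theorem exists_angle_mem_Icc (z : ℂ) :
    ∃ θ ∈ Icc (0 : ℝ) (2 * Real.pi), (‖z‖ : ℂ) * exp (θ * I) = z := by
  by_cases h0 : 0 ≤ arg z
  · exact ⟨arg z, ⟨h0, (arg_le_pi z).trans (by linarith [Real.pi_pos])⟩,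
      Complex.norm_mul_exp_arg_mul_I z⟩
  · refine ⟨arg z + 2 * Real.pi, ⟨by linarith [neg_pi_lt_arg z, Real.pi_pos], by linarith [not_le.mp h0]⟩, ?_⟩
    rw [Complex.ofReal_add, add_mul, Complex.exp_add]
    push_cast
    rw [Complex.exp_two_pi_mul_I, mul_one, Complex.norm_mul_exp_arg_mul_I]

/-- **Strong unique continuation for `‖∂̄h‖ ≤ M‖h‖`** (vector-valued). Let `h` be `C²` on the
punctured disc `B(0,R) ∖ {0}` with values in a complex inner-product space,
`‖Dh(z)1 + i Dh(z)i‖ ≤ M‖h z‖` there, and suppose `h` vanishes to infinite order at `0`: for every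
`m` there are `C, ρ > 0` with `‖h z‖ ≤ C‖z‖^m` on `B(0,ρ) ∖ {0}`. Then `h = 0` on `B(0,R) ∖ {0}`.
(By `circle_sqNorm_lower_bound`, a circle with `H(r₀) > 0` forces `H(r) ≥ c r^κ`, incompatible
with `H(r) ≤ 2πC² r^{2m}` for `2m > κ`; so all circle means vanish, hence `h` does.)
[cite: Carleman1939Unicite, Théorème 1; GarofaloLin1986, Thm 1.2] -/
theorem eq_zero_of_flat {h : ℂ → F} {R M : ℝ}
    (hh : ContDiffOn ℝ 2 h (ball (0 : ℂ) R \ {0}))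
    (hM : ∀ z ∈ ball (0 : ℂ) R \ {0}, ‖fderiv ℝ h z 1 + I • fderiv ℝ h z I‖ ≤ M * ‖h z‖)
    (hflat : ∀ m : ℕ, ∃ C ρ : ℝ, 0 < ρ ∧ ∀ z ∈ ball (0 : ℂ) ρ \ {0}, ‖h z‖ ≤ C * ‖z‖ ^ m) :
    ∀ z ∈ ball (0 : ℂ) R \ {0}, h z = 0 := by
  have h2π : (0 : ℝ) < 2 * Real.pi := by positivity
  -- Step 1: all circle means vanish
  have hH : ∀ r₀ : ℝ, 0 < r₀ → r₀ < R →
      ∫ θ in (0 : ℝ)..2 * Real.pi, ‖h (r₀ * exp (θ * I))‖ ^ 2 = 0 := by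
    intro r₀ hr₀ hr₀R
    by_contra hne
    have hnn : 0 ≤ ∫ θ in (0 : ℝ)..2 * Real.pi, ‖h (r₀ * exp (θ * I))‖ ^ 2 :=
      intervalIntegral.integral_nonneg h2π.le fun θ _ => by positivity
    have hpos : 0 < ∫ θ in (0 : ℝ)..2 * Real.pi, ‖h (r₀ * exp (θ * I))‖ ^ 2 :=
      lt_of_le_of_ne hnn (Ne.symm hne)
    obtain ⟨κ, hκ, hlow⟩ := circle_sqNorm_lower_bound hh hM hr₀ hr₀R hpos
    obtain ⟨m, hm⟩ : ∃ m : ℕ, κ < 2 * (m : ℝ) :=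
      ⟨⌈κ⌉₊ + 1, by push_cast; linarith [Nat.le_ceil κ]⟩
    obtain ⟨C, ρ, hρ, hC⟩ := hflat m
    set H₀ : ℝ := ∫ θ in (0 : ℝ)..2 * Real.pi, ‖h (r₀ * exp (θ * I))‖ ^ 2 with hH₀
    set A : ℝ := H₀ / r₀ ^ κ with hA_def
    have hA : 0 < A := div_pos hpos (Real.rpow_pos_of_pos hr₀ κ)
    set p : ℝ := 2 * (m : ℝ) - κ with hp_def
    have hp : 0 < p := by rw [hp_def]; linarith
    -- the two-sided bound on small circles
    have hineq : ∀ r : ℝ, 0 < r → r < ρ → r ≤ r₀ → A ≤ 2 * Real.pi * C ^ 2 * r ^ p := by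
      intro r hr hrρ hrle
      have hup : ∫ θ in (0 : ℝ)..2 * Real.pi, ‖h (r * exp (θ * I))‖ ^ 2 ≤
          2 * Real.pi * C ^ 2 * r ^ (2 * m) := by
        have hmono : ∫ θ in (0 : ℝ)..2 * Real.pi, ‖h (r * exp (θ * I))‖ ^ 2 ≤
            ∫ θ in (0 : ℝ)..2 * Real.pi, (C * r ^ m) ^ 2 := by
          refine intervalIntegral.integral_mono_on h2π.le
            ((continuous_norm_sq_circle hh.continuousOn hr (lt_of_le_of_lt hrle hr₀R)).intervalIntegrable
              _ _) (by simp) fun θ _ => ?_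
          have hz : (r : ℂ) * exp (θ * I) ∈ ball (0 : ℂ) ρ \ {0} := by
            refine ⟨?_, ?_⟩
            · rw [mem_ball, dist_zero_right, norm_ofReal_mul_exp_mul_I hr.le]; exact hrρ
            · have hne' : ‖(r : ℂ) * exp (θ * I)‖ ≠ 0 := by
                rw [norm_ofReal_mul_exp_mul_I hr.le]; exact hr.ne'
              exact norm_ne_zero_iff.mp hne'
          have hb := hC _ hz
          rw [norm_ofReal_mul_exp_mul_I hr.le] at hb
          exact pow_le_pow_left₀ (norm_nonneg _) hb 2
        calc _ ≤ ∫ θ in (0 : ℝ)..2 * Real.pi, (C * r ^ m) ^ 2 := hmono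
          _ = 2 * Real.pi * C ^ 2 * r ^ (2 * m) := by
            rw [intervalIntegral.integral_const, smul_eq_mul]; ring
      have hlo := hlow r hr hrle
      have h1 : H₀ * (r / r₀) ^ κ = A * r ^ κ := by
        rw [hA_def, Real.div_rpow hr.le hr₀.le]; ring
      have h2 : (2 * Real.pi * C ^ 2 * r ^ (2 * m) : ℝ) = 2 * Real.pi * C ^ 2 * r ^ p * r ^ κ := by
        have : (r ^ (2 * m) : ℝ) = r ^ p * r ^ κ := by
          rw [← Real.rpow_add hr, hp_def, sub_add_cancel, ← Real.rpow_natCast]; push_cast; ring_nf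
        rw [this]; ring
      have hchain : A * r ^ κ ≤ 2 * Real.pi * C ^ 2 * r ^ p * r ^ κ := by
        rw [← h1, ← h2]; exact hlo.trans hup
      exact le_of_mul_le_mul_right hchain (Real.rpow_pos_of_pos hr κ)
    -- let `r → 0⁺`
    have htend : Tendsto (fun r : ℝ => 2 * Real.pi * C ^ 2 * r ^ p) (𝓝[>] 0) (𝓝 0) := by
      have h0 : Tendsto (fun r : ℝ => r ^ p) (𝓝 (0 : ℝ)) (𝓝 0) := by
        have := (Real.continuousAt_rpow_const 0 p (Or.inr hp.le)).tendsto
        simpa [Real.zero_rpow hp.ne'] using this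
      simpa using (h0.mono_left nhdsWithin_le_nhds).const_mul (2 * Real.pi * C ^ 2)
    have hev1 : ∀ᶠ r in 𝓝[>] (0 : ℝ), 2 * Real.pi * C ^ 2 * r ^ p < A :=
      htend (Iio_mem_nhds hA)
    have hev2 : ∀ᶠ r in 𝓝[>] (0 : ℝ), r ∈ Ioo 0 (min ρ r₀) :=
      Ioo_mem_nhdsGT (lt_min hρ hr₀)
    obtain ⟨r, hr1, hr2⟩ := (hev1.and hev2).exists
    have := hineq r hr2.1 (hr2.2.trans_le (min_le_left _ _)) (hr2.2.le.trans (min_le_right _ _))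
    linarith
  -- Step 2: vanishing circle means of a continuous map force vanishing
  intro z hz
  have hzR : ‖z‖ < R := by simpa using hz.1
  have hz0 : 0 < ‖z‖ := norm_pos_iff.2 hz.2
  by_contra hne
  obtain ⟨θ₀, hθ₀, hzθ⟩ := exists_angle_mem_Icc z
  have hcont := continuous_norm_sq_circle hh.continuousOn hz0 hzR
  have hlt : (∫ θ in (0 : ℝ)..2 * Real.pi, (0 : ℝ)) <
      ∫ θ in (0 : ℝ)..2 * Real.pi, ‖h (‖z‖ * exp (θ * I))‖ ^ 2 :=
    intervalIntegral.integral_lt_integral_of_continuousOn_of_le_of_exists_lt h2π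
      continuousOn_const hcont.continuousOn (fun θ _ => by positivity)
      ⟨θ₀, hθ₀, by rw [hzθ]; exact pow_pos (norm_pos_iff.2 hne) 2⟩
  rw [intervalIntegral.integral_const, smul_zero, hH ‖z‖ hz0 hzR] at hlt
  exact lt_irrefl _ hlt

/-- **Finite order of vanishing.** Under the hypotheses of `eq_zero_of_flat`, a solution which is
not identically zero on the punctured disc does NOT vanish to infinite order at `0`: for some `m`,
no bound `‖h z‖ ≤ C‖z‖^m` holds near `0`. [cite: Carleman1939Unicite, Théorème 1; Wendl2020, Cor. B.21] -/
theorem exists_order_of_ne_zero {h : ℂ → F} {R M : ℝ}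
    (hh : ContDiffOn ℝ 2 h (ball (0 : ℂ) R \ {0}))
    (hM : ∀ z ∈ ball (0 : ℂ) R \ {0}, ‖fderiv ℝ h z 1 + I • fderiv ℝ h z I‖ ≤ M * ‖h z‖)
    (hne : ∃ z ∈ ball (0 : ℂ) R \ {0}, h z ≠ 0) :
    ∃ m : ℕ, ∀ C ρ : ℝ, 0 < ρ → ∃ z ∈ ball (0 : ℂ) ρ \ {0}, C * ‖z‖ ^ m < ‖h z‖ := by
  by_contra hcon
  push Not at hcon
  obtain ⟨z, hz, hzne⟩ := hne
  refine hzne (eq_zero_of_flat hh hM (fun m => ?_) z hz)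
  obtain ⟨C, ρ, hρ, hC⟩ := hcon m
  exact ⟨C, ρ, hρ, hC⟩

end DbarFrequency

end Literature.Analysis.Complex

end
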